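import Summits.QuantumFields.YangMills.Theorems.FluctuationComparisonRegPrIntLBackgroundFormAlgebra
import Literature.MathematicalPhysics.QuantumFieldTheory.Balaban1983to89.T3MinimiserStabilityReduction
import Literature.MathematicalPhysics.QuantumFieldTheory.Balaban1983to89.T3PrintedRegularMinimiser
import Literature.MathematicalPhysics.QuantumFieldTheory.Balaban1983to89.T3OrbitAverage
import Literature.MathematicalPhysics.QuantumFieldTheory.Balaban1983to89.B12ContinuousTransportInvariance
import Literature.MathematicalPhysics.QuantumFieldTheory.Balaban1983to89.Node00.CanonicalTransportOfRecord
import HarnessLib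

/-!
# LINE g24-4 «BACKGROUND FORM», LIFTED INTO `Theorems/`: BGFORM∘ ⟹ S2β (registry :412 VERBATIM) AND BGFORM∘ ⟹ GRAD∘, DEFINITION-FREE

Cell `ym3-torus` (YM ladder rung R3 = continuum `SU(2)` Yang–Mills on the three-torus — a RUNG, NOT d = 4, NOT infinite volume, NOT a mass gap, NOT Clay).  Width seat
`ym-ust-20520-w3` (gen 20, LEAD-20520 by lineage); `--supports stmt-QuantumFields-20520 --as helper`, count-neutral, definition-free, default heartbeats; no registry,
binder or `Lines/` edit; the registered skeleton `Lines/semiclassical_s2beta.lean` v11.4 and its five stubs are untouched (0∕5).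

WHAT THIS IS.  Ideator `ym-r3-idea-1` g24's LINE №14 = g24-4 «background_form» (`Cruxes/FluctuationComparisonRegPrIntL/Lines/background_form.lean` sha16
5f0065306aa4d283 §3; card `Lines/background_form.md` 31eaefb9631e87d5) PROVES, from its one row **BGFORM∘** `FluctuationBackgroundFormCan` (§1 there; print-shaped:
on the window `log ρ U + β_K𝔄^reg U = c₀ + Σ_X T X (M U)` with a BACKGROUND MAP `M` — reading: the minimal configuration `U_k(V)` of [Balaban1985Variational] Prop. 9
p.309 in print's gauge — terms `T X` LIPSCHITZ (`ℓ X`, one-pin sums `≤ A`) and DISCRETE-C^{1,1} (`h X`, two-pin sums `≤ H e^{−2μd(e,e′)}`) in the background variables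
ON `X` ([Balaban1987RG1] (0.22)–(0.25) pp.256–257, Thm 1 p.259; [Balaban1989LargeFieldII] (1.98)–(1.100) p.390), response bounds of `M` (one bond
`≤ σ_J e^{−2μd(πb,e)}`, mixed `≤ σ₂,J e^{−2μd(πb,e)} e^{−2μd(e,πb′)}`, [Balaban1985Variational] (182)–(190) pp.307–308), `σ, σ₂` super-polynomially small in `J`, on a
pseudo-metric `d` of the level-`K` bonds with a volume-uniform summability constant `C` and `κ·tdist_J ≤ μ·d(πb,πb′)`), BOTH the PATH-B organ **S2β**
`RunPairOrgan.OneLoop.FluctuationPartSmall` (registry `Lines/semiclassical_s2beta.lean` v11.4 :412) and LINE g24-1's first-order row **GRAD∘** `OneBondOscillationCan`.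
Crux workfiles are not importable, so this file LIFTS those two junction theorems into `Theorems/` with the three statements written out VERBATIM as
propositions (no `def`): ★`fluctuationPartSmall_of_backgroundForm : ⟨BGFORM∘⟩ → ⟨S2β⟩` (`κ_{S2β} := κ`, `φ_J := H·C′²·σ_J² + A·C′·σ₂,J`, `C′ = max C 0`; S2β's
`e^{−κ·tdist}` is MANUFACTURED from the background response by two-pin exchange and the three-factor exponential convolution) and
★`oneBondOscillation_of_backgroundForm : ⟨BGFORM∘⟩ → ⟨GRAD∘⟩` (`σ^{GRAD}_J := A·C′·σ_J`).  Proofs: g24's §3 verbatim over the lifted toolkit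
✓`…BackgroundFormAlgebra` (`oneBond_le_of_sensitivity`, `fourPoint_le_of_sensitivity`, `sum_mul_sum_supp_le`, `sum_mul_sum_mul_sum_supp_le`, `exp_convolution_le`,
`exp_convolution_two_le`, `exp_two_mul_le`, `tendsto_phi_of_superpoly`, `superpoly_const_mul`).  All credit for the mathematics: ideator g24 (this seat only lifts).
Door-fit against the Lines' own `def`s (pasted) is certified separately by `example`s in the seat's HOME folder (`DOORFIT-H-vs-Lines.lean`).

POSITION IN THE CONE (g24's card, honest).  Cones for S2β on file: registry {EXW, GAP♯, DET-REP-B‴, H4ᶜ∘, LFR♯ᶜ∘}; g24-1 {GRAD∘, CRUDELOC}; g24-2 {OSC¹∘, TAILSUP∘,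
CRUDELOC}; g24-3 {POLY∘} (in `Theorems/`: ✓`…PolymerNormKnit` ∕ `…PolymerTreeKnit` ∕ `…PolymerAnalyticKnit` ∕ `…PolymerMayerGas` ∕ `…PolymerAnalyticAdd`); g24-4
{BGFORM∘} (this file).  BGFORM∘ is WEAKER than POLY∘ and closer to print (of g24-3's two unprinted load-bearing steps it needs only (a) the last Mayer step — whose
abstract T³ form is ✓`…PolymerMayerGas.exists_localized_log_gas`); it is a DOCKING ROW (stronger than S2β; anti-reduction acknowledged on the card).
WHY IT MIGHT FAIL (card): (a) last Mayer step vs stratum entropy; (b) dictionary `descend`∕`ℰp`; (c) moduli = corollaries of (0.25) + analyticity + Cauchy; (d) torons;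
(f) product-kernel shape of the mixed response (Cauchy shape, unprinted); (g) gauge fixing is the prover's.

HONEST: two knits; BGFORM∘ is a HYPOTHESIS (the line's one stub, XL) and appears here only as an antecedent; nothing of Bałaban's is asserted or proved; S2β and
GRAD∘ are proved only modulo BGFORM∘; `FluctuationComparisonRegPrIntL` (20520) and `YM3TorusSU2` are NOT proved; no summit ∕ sub-problem statement is proved.
[cite: Balaban1985Variational, Prop. 9 p.309, (182)-(190) pp.307-308; Balaban1987RG1, (0.22)-(0.25) pp.256-257, Thm 1 p.259; Balaban1989LargeFieldII, (1.98)-(1.100) p.390; Balaban1985UV3, Thm 2 p.263 and (41) p.266]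
-/

set_option autoImplicit false

noncomputable section

namespace Summit.QuantumFields.YangMills.Theorems.FluctuationComparisonRegPrIntLBackgroundFormKnit

open MeasureTheory Filter Topology Set
open scoped BigOperators
open Literature.MathematicalPhysics.QuantumFieldTheory.Balaban1983to89
open Literature.MathematicalPhysics.QuantumFieldTheory.Balaban1983to89.T3ContinuumYM3Torus
open Literature.MathematicalPhysics.QuantumFieldTheory.Balaban1983to89.T3NestedUnitLaws
open Literature.MathematicalPhysics.QuantumFieldTheory.Balaban1983to89.T3UnitLawDensityEML
open Literature.MathematicalPhysics.QuantumFieldTheory.Balaban1983to89.T3UnitScaleTilt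
open Literature.MathematicalPhysics.QuantumFieldTheory.Balaban1983to89.T3TiltDescent
open Literature.MathematicalPhysics.QuantumFieldTheory.Balaban1983to89.T3PrintedRegularMinimiser
open Literature.MathematicalPhysics.QuantumFieldTheory.Balaban1983to89.T3ConstrainedMinimiser (fibre)
open Literature.MathematicalPhysics.QuantumFieldTheory.Balaban1983to89.T3LevelShift
open Literature.MathematicalPhysics.QuantumFieldTheory.Balaban1983to89.Missing
open Literature.MathematicalPhysics.QuantumFieldTheory.Balaban1983to89.T4Continuum
open Summit.QuantumFields.YangMills.Theorems.FluctuationComparisonRegPrIntLBackgroundFormAlgebra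

/-! ## §1 BGFORM∘ ⟹ GRAD∘ -/

/-- ★ **BGFORM∘ ⟹ GRAD∘** (LINE g24-4 §3, lifted; statements VERBATIM: antecedent = `Lines/background_form.lean` §1 `FluctuationBackgroundFormCan`, conclusion =
LINE g24-1 `Lines/gradient_split.lean` §0 `OneBondOscillationCan`): Lipschitz terms × one-bond response × one-pin exchange; `σ^{GRAD}_J := A·(max C 0)·σ_J`.
Proof g24's. [cite: Balaban1987RG1, Thm 1 (0.24)-(0.25) p.257; Balaban1989LargeFieldII, (1.98)-(1.100) p.390; Balaban1985Variational, Prop. 9 p.309] -/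
theorem oneBondOscillation_of_backgroundForm
    (hB :
      ∀ (L : ℕ), ∃ pS : ℝ, ∀ (b₀ p₀ : ℝ), 0 < b₀ → pS ≤ p₀ → 0 < p₀ → ∃ ε₁ : ℝ, 0 < ε₁ ∧ ∀ (ε₀ : ℝ), 0 < ε₀ → ε₀ ≤ ε₁ →
        ∃ γ₁ : ℝ, 0 < γ₁ ∧ ∃ (κ μ C A Hc : ℝ), 0 < κ ∧ 0 ≤ μ ∧ 0 ≤ A ∧ 0 ≤ Hc ∧ ∀ (F : T3Family) (γ : ℝ), F.L = L → 0 < γ → γ ≤ γ₁ →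
          ∃ (σ σ₂ : ℕ → ℝ), (∀ J, 0 ≤ σ J) ∧ (∀ J, 0 ≤ σ₂ J) ∧
            (∀ a : ℕ, Tendsto (fun J : ℕ => ((J : ℝ) + 1) ^ a * σ J) atTop (𝓝 0)) ∧
            (∀ a : ℕ, Tendsto (fun J : ℕ => ((J : ℝ) + 1) ^ a * σ₂ J) atTop (𝓝 0)) ∧
            ∀ (ν : ℕ → (j : ℕ) → Measure (GaugeField (F.P j) 0 (Matrix.specialUnitaryGroup (Fin 2) ℂ))),
              (∀ K, ν K K = T4GenFunBounds.gibbsMeasure (F.P K) ((F.scheme ℰp γ).β K)) →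
              (∀ K j, j < K → ν K j = Measure.map (descend F ℰp j) (ν K (j + 1))) →
              ∀ (J K : ℕ) (hJK : J ≤ K) (ρ : GaugeField (F.P J) 0 (Matrix.specialUnitaryGroup (Fin 2) ℂ) → ℝ),
                (∀ U, PlaqSmall (θBal F.L γ b₀ p₀ J) U → 0 < ρ U) →
                ν K J = (fieldMeasure _ _ _).withDensity (fun U => ENNReal.ofReal (ρ U)) →
                ContinuousOn ρ {U | PlaqSmall (θBal F.L γ b₀ p₀ J) U} →
                ∃ (c₀ : ℝ) (π : PBond (F.P J) 0 → PBond (F.P K) 0) (d : PBond (F.P K) 0 → PBond (F.P K) 0 → ℝ)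
                  (M : GaugeField (F.P J) 0 (Matrix.specialUnitaryGroup (Fin 2) ℂ) → PBond (F.P K) 0 → (Fin 8 → ℝ))
                  (T : Finset (PBond (F.P K) 0) → (PBond (F.P K) 0 → (Fin 8 → ℝ)) → ℝ)
                  (ℓ h : Finset (PBond (F.P K) 0) → ℝ),
                  (∀ x y, 0 ≤ d x y) ∧ (∀ x y, d x y = d y x) ∧ (∀ x y z, d x z ≤ d x y + d y z) ∧
                  (∀ x, ∑ y, Real.exp (-(μ * d x y)) ≤ C) ∧
                  (∀ b b' : PBond (F.P J) 0, κ * (b.src.tdist b'.src : ℝ) ≤ μ * d (π b) (π b')) ∧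
                  (∀ X, 0 ≤ ℓ X) ∧ (∀ X, 0 ≤ h X) ∧
                  (∀ e, ∑ X ∈ Finset.univ.filter (fun X => e ∈ X), ℓ X ≤ A) ∧
                  (∀ e e', ∑ X ∈ Finset.univ.filter (fun X => e ∈ X ∧ e' ∈ X), h X ≤ Hc * Real.exp (-(2 * μ * d e e'))) ∧
                  (∀ (X : Finset (PBond (F.P K) 0)) (U V : GaugeField (F.P J) 0 (Matrix.specialUnitaryGroup (Fin 2) ℂ)),
                      PlaqSmall (θBal F.L γ b₀ p₀ J) U → PlaqSmall (θBal F.L γ b₀ p₀ J) V →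
                      |T X (M U) - T X (M V)| ≤ ℓ X * ∑ e ∈ X, ‖M U e - M V e‖) ∧
                  (∀ (X : Finset (PBond (F.P K) 0)) (U V W Z : GaugeField (F.P J) 0 (Matrix.specialUnitaryGroup (Fin 2) ℂ)),
                      PlaqSmall (θBal F.L γ b₀ p₀ J) U → PlaqSmall (θBal F.L γ b₀ p₀ J) V →
                      PlaqSmall (θBal F.L γ b₀ p₀ J) W → PlaqSmall (θBal F.L γ b₀ p₀ J) Z →
                      |T X (M U) - T X (M W) - T X (M V) + T X (M Z)| ≤
                        h X * (∑ e ∈ X, ‖M W e - M Z e‖) * (∑ e ∈ X, ‖M V e - M Z e‖) +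
                          ℓ X * ∑ e ∈ X, ‖M U e - M W e - M V e + M Z e‖) ∧
                  (∀ (b : PBond (F.P J) 0) (U V : GaugeField (F.P J) 0 (Matrix.specialUnitaryGroup (Fin 2) ℂ)),
                      PlaqSmall (θBal F.L γ b₀ p₀ J) U → PlaqSmall (θBal F.L γ b₀ p₀ J) V → (∀ e, e ≠ b → U e = V e) →
                      ∀ e, ‖M U e - M V e‖ ≤ σ J * Real.exp (-(2 * μ * d (π b) e))) ∧
                  (∀ (b b' : PBond (F.P J) 0) (U V W Z : GaugeField (F.P J) 0 (Matrix.specialUnitaryGroup (Fin 2) ℂ)),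
                      PlaqSmall (θBal F.L γ b₀ p₀ J) U → PlaqSmall (θBal F.L γ b₀ p₀ J) V →
                      PlaqSmall (θBal F.L γ b₀ p₀ J) W → PlaqSmall (θBal F.L γ b₀ p₀ J) Z →
                      (∀ e, e ≠ b → U e = V e) → (∀ e, e ≠ b' → U e = W e) → (∀ e, e ≠ b' → V e = Z e) → (∀ e, e ≠ b → W e = Z e) →
                      ∀ e, ‖M U e - M W e - M V e + M Z e‖ ≤
                        σ₂ J * (Real.exp (-(2 * μ * d (π b) e)) * Real.exp (-(2 * μ * d e (π b'))))) ∧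
                  (∀ U : GaugeField (F.P J) 0 (Matrix.specialUnitaryGroup (Fin 2) ℂ), PlaqSmall (θBal F.L γ b₀ p₀ J) U →
                      Real.log (ρ U) + (F.scheme ℰp γ).β K * minActionRegPr F J K hJK ε₀ U = c₀ + ∑ X, T X (M U))) :
    ∀ (L : ℕ), ∃ pS : ℝ, ∀ (b₀ p₀ : ℝ), 0 < b₀ → pS ≤ p₀ → 0 < p₀ → ∃ ε₁ : ℝ, 0 < ε₁ ∧ ∀ (ε₀ : ℝ), 0 < ε₀ → ε₀ ≤ ε₁ →
      ∃ γ₁ : ℝ, 0 < γ₁ ∧ ∀ (F : T3Family) (γ : ℝ), F.L = L → 0 < γ → γ ≤ γ₁ →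
        ∃ (σ : ℕ → ℝ), (∀ J, 0 ≤ σ J) ∧ (∀ a : ℕ, Tendsto (fun J : ℕ => ((J : ℝ) + 1) ^ a * σ J) atTop (𝓝 0)) ∧
          ∀ (ν : ℕ → (j : ℕ) → Measure (GaugeField (F.P j) 0 (Matrix.specialUnitaryGroup (Fin 2) ℂ))),
            (∀ K, ν K K = T4GenFunBounds.gibbsMeasure (F.P K) ((F.scheme ℰp γ).β K)) →
            (∀ K j, j < K → ν K j = Measure.map (descend F ℰp j) (ν K (j + 1))) →
            ∀ (J K : ℕ) (hJK : J ≤ K) (ρ : GaugeField (F.P J) 0 (Matrix.specialUnitaryGroup (Fin 2) ℂ) → ℝ),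
              (∀ U, PlaqSmall (θBal F.L γ b₀ p₀ J) U → 0 < ρ U) →
              ν K J = (fieldMeasure _ _ _).withDensity (fun U => ENNReal.ofReal (ρ U)) →
              ContinuousOn ρ {U | PlaqSmall (θBal F.L γ b₀ p₀ J) U} →
              ∀ (b : PBond (F.P J) 0) (U V : GaugeField (F.P J) 0 (Matrix.specialUnitaryGroup (Fin 2) ℂ)),
                PlaqSmall (θBal F.L γ b₀ p₀ J) U → PlaqSmall (θBal F.L γ b₀ p₀ J) V →
                (∀ e, e ≠ b → U e = V e) →
                |(Real.log (ρ U) + (F.scheme ℰp γ).β K * minActionRegPr F J K hJK ε₀ U)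
                    - (Real.log (ρ V) + (F.scheme ℰp γ).β K * minActionRegPr F J K hJK ε₀ V)| ≤ σ J := by
  intro L
  obtain ⟨pS, HpS⟩ := hB L
  refine ⟨pS, ?_⟩
  intro b₀ p₀ hb₀ hpS hp₀
  obtain ⟨ε₁, hε₁, Hε⟩ := HpS b₀ p₀ hb₀ hpS hp₀
  refine ⟨ε₁, hε₁, ?_⟩
  intro ε₀ hε₀ hε₀₁
  obtain ⟨γ₁, hγ₁, κ, μ, C, A, Hc, _hκ, hμ, hA, _hHc, HF⟩ := Hε ε₀ hε₀ hε₀₁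
  refine ⟨γ₁, hγ₁, ?_⟩
  intro F γ hFL hγ hγ₁'
  obtain ⟨σ, σ₂, hσ0, _hσ₂0, hσ, _hσ₂, Hν⟩ := HF F γ hFL hγ hγ₁'
  refine ⟨fun J => A * max C 0 * σ J, fun J => mul_nonneg (mul_nonneg hA (le_max_right _ _)) (hσ0 J),
    superpoly_const_mul (A * max C 0) hσ, ?_⟩
  intro ν hνK hνd J K hJK ρ hρpos hρν hρcont b U V hU hV hUV
  obtain ⟨c₀, π, d, M, T, ℓ, h, hd0, _hdsym, _hdtri, hdsum, _hdcmp, hℓ0, _hh0, hpin1, _hpin2, hlip, _hC11, hsens1, _hsens2, hrep⟩ :=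
    Hν ν hνK hνd J K hJK ρ hρpos hρν hρcont
  set S : Set (GaugeField (F.P J) 0 (Matrix.specialUnitaryGroup (Fin 2) ℂ)) := {U | PlaqSmall (θBal F.L γ b₀ p₀ J) U} with hS
  have key := oneBond_le_of_sensitivity (𝓧 := Finset (PBond (F.P K) 0)) (fun X => X) T ℓ M S (M '' S) c₀
    (fun U => Real.log (ρ U) + (F.scheme ℰp γ).β K * minActionRegPr F J K hJK ε₀ U)
    (fun (b : PBond (F.P J) 0) (e : PBond (F.P K) 0) => σ J * Real.exp (-(2 * μ * d (π b) e)))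
    hℓ0 (fun V hV => ⟨V, hV, rfl⟩)
    (by
      rintro X _ _ ⟨U', hU', rfl⟩ ⟨V', hV', rfl⟩
      exact hlip X U' V' hU' hV')
    (fun V hV => hrep V hV) b U V hU hV (hsens1 b U V hU hV hUV)
  refine key.trans ?_
  have hC0 : 0 ≤ max C 0 := le_max_right _ _
  have hB : ∑ e, σ J * Real.exp (-(2 * μ * d (π b) e)) ≤ σ J * max C 0 := by
    rw [← Finset.mul_sum]
    refine mul_le_mul_of_nonneg_left ?_ (hσ0 J)
    calc ∑ e, Real.exp (-(2 * μ * d (π b) e)) ≤ ∑ e, Real.exp (-(μ * d (π b) e)) :=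
          Finset.sum_le_sum fun e _ => exp_two_mul_le μ _ hμ (hd0 _ _)
      _ ≤ C := hdsum (π b)
      _ ≤ max C 0 := le_max_left _ _
  have := sum_mul_sum_supp_le (fun X : Finset (PBond (F.P K) 0) => X) ℓ
    (fun e => σ J * Real.exp (-(2 * μ * d (π b) e))) A (σ J * max C 0)
    (fun e => mul_nonneg (hσ0 J) (Real.exp_pos _).le) hpin1 hB hA
  calc ∑ X, ℓ X * ∑ e ∈ X, σ J * Real.exp (-(2 * μ * d (π b) e)) ≤ A * (σ J * max C 0) := this
    _ = A * max C 0 * σ J := by ring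

/-! ## §2 BGFORM∘ ⟹ S2β -/

/-- ★ **BGFORM∘ ⟹ S2β** (LINE g24-4 §3, lifted; statements VERBATIM: antecedent = `Lines/background_form.lean` §1 `FluctuationBackgroundFormCan`, conclusion = the
PATH-B organ `RunPairOrgan.OneLoop.FluctuationPartSmall`, registry `Lines/semiclassical_s2beta.lean` v11.4 :412): C^{1,1} terms × first- and mixed second-order
response × two-pin exchange × exponential convolutions; `κ_{S2β} := κ`, `φ_J := H·C′²·σ_J² + A·C′·σ₂,J` (`C′ = max C 0`).  Proof g24's.
[cite: Balaban1985UV3, Thm 2 p.263 and (41) p.266; Balaban1987RG1, (0.22)-(0.25) pp.256-257; Balaban1985Variational, (182)-(190) pp.307-308] -/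
theorem fluctuationPartSmall_of_backgroundForm
    (hB :
      ∀ (L : ℕ), ∃ pS : ℝ, ∀ (b₀ p₀ : ℝ), 0 < b₀ → pS ≤ p₀ → 0 < p₀ → ∃ ε₁ : ℝ, 0 < ε₁ ∧ ∀ (ε₀ : ℝ), 0 < ε₀ → ε₀ ≤ ε₁ →
        ∃ γ₁ : ℝ, 0 < γ₁ ∧ ∃ (κ μ C A Hc : ℝ), 0 < κ ∧ 0 ≤ μ ∧ 0 ≤ A ∧ 0 ≤ Hc ∧ ∀ (F : T3Family) (γ : ℝ), F.L = L → 0 < γ → γ ≤ γ₁ →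
          ∃ (σ σ₂ : ℕ → ℝ), (∀ J, 0 ≤ σ J) ∧ (∀ J, 0 ≤ σ₂ J) ∧
            (∀ a : ℕ, Tendsto (fun J : ℕ => ((J : ℝ) + 1) ^ a * σ J) atTop (𝓝 0)) ∧
            (∀ a : ℕ, Tendsto (fun J : ℕ => ((J : ℝ) + 1) ^ a * σ₂ J) atTop (𝓝 0)) ∧
            ∀ (ν : ℕ → (j : ℕ) → Measure (GaugeField (F.P j) 0 (Matrix.specialUnitaryGroup (Fin 2) ℂ))),
              (∀ K, ν K K = T4GenFunBounds.gibbsMeasure (F.P K) ((F.scheme ℰp γ).β K)) →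
              (∀ K j, j < K → ν K j = Measure.map (descend F ℰp j) (ν K (j + 1))) →
              ∀ (J K : ℕ) (hJK : J ≤ K) (ρ : GaugeField (F.P J) 0 (Matrix.specialUnitaryGroup (Fin 2) ℂ) → ℝ),
                (∀ U, PlaqSmall (θBal F.L γ b₀ p₀ J) U → 0 < ρ U) →
                ν K J = (fieldMeasure _ _ _).withDensity (fun U => ENNReal.ofReal (ρ U)) →
                ContinuousOn ρ {U | PlaqSmall (θBal F.L γ b₀ p₀ J) U} →
                ∃ (c₀ : ℝ) (π : PBond (F.P J) 0 → PBond (F.P K) 0) (d : PBond (F.P K) 0 → PBond (F.P K) 0 → ℝ)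
                  (M : GaugeField (F.P J) 0 (Matrix.specialUnitaryGroup (Fin 2) ℂ) → PBond (F.P K) 0 → (Fin 8 → ℝ))
                  (T : Finset (PBond (F.P K) 0) → (PBond (F.P K) 0 → (Fin 8 → ℝ)) → ℝ)
                  (ℓ h : Finset (PBond (F.P K) 0) → ℝ),
                  (∀ x y, 0 ≤ d x y) ∧ (∀ x y, d x y = d y x) ∧ (∀ x y z, d x z ≤ d x y + d y z) ∧
                  (∀ x, ∑ y, Real.exp (-(μ * d x y)) ≤ C) ∧
                  (∀ b b' : PBond (F.P J) 0, κ * (b.src.tdist b'.src : ℝ) ≤ μ * d (π b) (π b')) ∧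
                  (∀ X, 0 ≤ ℓ X) ∧ (∀ X, 0 ≤ h X) ∧
                  (∀ e, ∑ X ∈ Finset.univ.filter (fun X => e ∈ X), ℓ X ≤ A) ∧
                  (∀ e e', ∑ X ∈ Finset.univ.filter (fun X => e ∈ X ∧ e' ∈ X), h X ≤ Hc * Real.exp (-(2 * μ * d e e'))) ∧
                  (∀ (X : Finset (PBond (F.P K) 0)) (U V : GaugeField (F.P J) 0 (Matrix.specialUnitaryGroup (Fin 2) ℂ)),
                      PlaqSmall (θBal F.L γ b₀ p₀ J) U → PlaqSmall (θBal F.L γ b₀ p₀ J) V →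
                      |T X (M U) - T X (M V)| ≤ ℓ X * ∑ e ∈ X, ‖M U e - M V e‖) ∧
                  (∀ (X : Finset (PBond (F.P K) 0)) (U V W Z : GaugeField (F.P J) 0 (Matrix.specialUnitaryGroup (Fin 2) ℂ)),
                      PlaqSmall (θBal F.L γ b₀ p₀ J) U → PlaqSmall (θBal F.L γ b₀ p₀ J) V →
                      PlaqSmall (θBal F.L γ b₀ p₀ J) W → PlaqSmall (θBal F.L γ b₀ p₀ J) Z →
                      |T X (M U) - T X (M W) - T X (M V) + T X (M Z)| ≤
                        h X * (∑ e ∈ X, ‖M W e - M Z e‖) * (∑ e ∈ X, ‖M V e - M Z e‖) +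
                          ℓ X * ∑ e ∈ X, ‖M U e - M W e - M V e + M Z e‖) ∧
                  (∀ (b : PBond (F.P J) 0) (U V : GaugeField (F.P J) 0 (Matrix.specialUnitaryGroup (Fin 2) ℂ)),
                      PlaqSmall (θBal F.L γ b₀ p₀ J) U → PlaqSmall (θBal F.L γ b₀ p₀ J) V → (∀ e, e ≠ b → U e = V e) →
                      ∀ e, ‖M U e - M V e‖ ≤ σ J * Real.exp (-(2 * μ * d (π b) e))) ∧
                  (∀ (b b' : PBond (F.P J) 0) (U V W Z : GaugeField (F.P J) 0 (Matrix.specialUnitaryGroup (Fin 2) ℂ)),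
                      PlaqSmall (θBal F.L γ b₀ p₀ J) U → PlaqSmall (θBal F.L γ b₀ p₀ J) V →
                      PlaqSmall (θBal F.L γ b₀ p₀ J) W → PlaqSmall (θBal F.L γ b₀ p₀ J) Z →
                      (∀ e, e ≠ b → U e = V e) → (∀ e, e ≠ b' → U e = W e) → (∀ e, e ≠ b' → V e = Z e) → (∀ e, e ≠ b → W e = Z e) →
                      ∀ e, ‖M U e - M W e - M V e + M Z e‖ ≤
                        σ₂ J * (Real.exp (-(2 * μ * d (π b) e)) * Real.exp (-(2 * μ * d e (π b'))))) ∧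
                  (∀ U : GaugeField (F.P J) 0 (Matrix.specialUnitaryGroup (Fin 2) ℂ), PlaqSmall (θBal F.L γ b₀ p₀ J) U →
                      Real.log (ρ U) + (F.scheme ℰp γ).β K * minActionRegPr F J K hJK ε₀ U = c₀ + ∑ X, T X (M U))) :
    ∀ (L : ℕ), ∃ pS : ℝ, ∀ (b₀ p₀ : ℝ), 0 < b₀ → pS ≤ p₀ → 0 < p₀ → ∃ ε₁ : ℝ, 0 < ε₁ ∧ ∀ (ε₀ : ℝ), 0 < ε₀ → ε₀ ≤ ε₁ →
      ∃ γ₁ : ℝ, 0 < γ₁ ∧ ∃ κ : ℝ, 0 < κ ∧ ∀ (F : T3Family) (γ : ℝ), F.L = L → 0 < γ → γ ≤ γ₁ →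
        ∃ (φ : ℕ → ℝ), (∀ J, 0 ≤ φ J) ∧ Tendsto (fun J : ℕ => (J : ℝ) * φ J) atTop (𝓝 0) ∧
          ∀ (ν : ℕ → (j : ℕ) → Measure (GaugeField (F.P j) 0 (Matrix.specialUnitaryGroup (Fin 2) ℂ))),
            (∀ K, ν K K = T4GenFunBounds.gibbsMeasure (F.P K) ((F.scheme ℰp γ).β K)) →
            (∀ K j, j < K → ν K j = Measure.map (descend F ℰp j) (ν K (j + 1))) →
            ∀ (J K : ℕ) (hJK : J ≤ K) (ρ : GaugeField (F.P J) 0 (Matrix.specialUnitaryGroup (Fin 2) ℂ) → ℝ),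
              (∀ U, PlaqSmall (θBal F.L γ b₀ p₀ J) U → 0 < ρ U) →
              ν K J = (fieldMeasure _ _ _).withDensity (fun U => ENNReal.ofReal (ρ U)) →
              ContinuousOn ρ {U | PlaqSmall (θBal F.L γ b₀ p₀ J) U} →
              ∀ (b b' : PBond (F.P J) 0) (U V W Z : GaugeField (F.P J) 0 (Matrix.specialUnitaryGroup (Fin 2) ℂ)),
                PlaqSmall (θBal F.L γ b₀ p₀ J) U → PlaqSmall (θBal F.L γ b₀ p₀ J) V →
                PlaqSmall (θBal F.L γ b₀ p₀ J) W → PlaqSmall (θBal F.L γ b₀ p₀ J) Z →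
                (∀ e, e ≠ b → U e = V e) → (∀ e, e ≠ b' → U e = W e) → (∀ e, e ≠ b' → V e = Z e) → (∀ e, e ≠ b → W e = Z e) →
                |((Real.log (ρ U) + (F.scheme ℰp γ).β K * minActionRegPr F J K hJK ε₀ U)
                    - (Real.log (ρ V) + (F.scheme ℰp γ).β K * minActionRegPr F J K hJK ε₀ V))
                  - ((Real.log (ρ W) + (F.scheme ℰp γ).β K * minActionRegPr F J K hJK ε₀ W)
                    - (Real.log (ρ Z) + (F.scheme ℰp γ).β K * minActionRegPr F J K hJK ε₀ Z))|
                  ≤ φ J * Real.exp (-(κ * (b.src.tdist b'.src : ℝ))) := by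
  intro L
  obtain ⟨pS, HpS⟩ := hB L
  refine ⟨pS, ?_⟩
  intro b₀ p₀ hb₀ hpS hp₀
  obtain ⟨ε₁, hε₁, Hε⟩ := HpS b₀ p₀ hb₀ hpS hp₀
  refine ⟨ε₁, hε₁, ?_⟩
  intro ε₀ hε₀ hε₀₁
  obtain ⟨γ₁, hγ₁, κ, μ, C, A, Hc, hκ, hμ, hA, hHc, HF⟩ := Hε ε₀ hε₀ hε₀₁
  refine ⟨γ₁, hγ₁, κ, hκ, ?_⟩
  intro F γ hFL hγ hγ₁'
  obtain ⟨σ, σ₂, hσ0, hσ₂0, hσ, hσ₂, Hν⟩ := HF F γ hFL hγ hγ₁'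
  set C' : ℝ := max C 0 with hC'
  have hC'0 : 0 ≤ C' := le_max_right _ _
  refine ⟨fun J => Hc * C' ^ 2 * σ J ^ 2 + A * C' * σ₂ J,
    fun J => add_nonneg (mul_nonneg (mul_nonneg hHc (sq_nonneg _)) (sq_nonneg _)) (mul_nonneg (mul_nonneg hA hC'0) (hσ₂0 J)),
    tendsto_phi_of_superpoly Hc C' A hσ0 hσ₂0 hσ hσ₂, ?_⟩
  intro ν hνK hνd J K hJK ρ hρpos hρν hρcont b b' U V W Z hU hV hW hZ hUV hUW hVZ hWZ
  obtain ⟨c₀, π, d, M, T, ℓ, h, hd0, hdsym, hdtri, hdsum, hdcmp, hℓ0, hh0, hpin1, hpin2, hlip, hC11, hsens1, hsens2, hrep⟩ :=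
    Hν ν hνK hνd J K hJK ρ hρpos hρν hρcont
  have hdsum' : ∀ x, ∑ y, Real.exp (-(μ * d x y)) ≤ C' := fun x => (hdsum x).trans (le_max_left _ _)
  set S : Set (GaugeField (F.P J) 0 (Matrix.specialUnitaryGroup (Fin 2) ℂ)) := {U | PlaqSmall (θBal F.L γ b₀ p₀ J) U} with hS
  set f : GaugeField (F.P J) 0 (Matrix.specialUnitaryGroup (Fin 2) ℂ) → ℝ :=
    fun U => Real.log (ρ U) + (F.scheme ℰp γ).β K * minActionRegPr F J K hJK ε₀ U with hf
  set s : PBond (F.P J) 0 → PBond (F.P K) 0 → ℝ := fun b e => σ J * Real.exp (-(2 * μ * d (π b) e)) with hs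
  set s₂ : PBond (F.P J) 0 → PBond (F.P J) 0 → PBond (F.P K) 0 → ℝ :=
    fun b b' e => σ₂ J * (Real.exp (-(2 * μ * d (π b) e)) * Real.exp (-(2 * μ * d e (π b')))) with hs₂
  have hs0 : ∀ b e, 0 ≤ s b e := fun b e => mul_nonneg (hσ0 J) (Real.exp_pos _).le
  -- the square: V₀₀ := Z, V₁₀ := W (moved at b), V₀₁ := V (moved at b'), V₁₁ := U
  have key := fourPoint_le_of_sensitivity (𝓧 := Finset (PBond (F.P K) 0)) (fun X => X) T ℓ h M S (M '' S) c₀ f s s₂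
    hℓ0 hh0 hs0 (fun V hV => ⟨V, hV, rfl⟩)
    (by
      rintro X _ _ _ _ ⟨Z', hZ', rfl⟩ ⟨W', hW', rfl⟩ ⟨V', hV', rfl⟩ ⟨U', hU', rfl⟩
      exact hC11 X U' V' W' Z' hU' hV' hW' hZ')
    (fun V hV => hrep V hV) b b' Z W V U hZ hW hV hU
    (fun e => by
      have := hsens1 b W Z hW hZ hWZ e
      simpa [hs] using this)
    (fun e => by
      have := hsens1 b' V Z hV hZ hVZ e
      simpa [hs] using this)
    (fun e => by
      have := hsens2 b b' U V W Z hU hV hW hZ hUV hUW hVZ hWZ e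
      simpa [hs₂] using this)
  have hrw : (f U - f V) - (f W - f Z) = f U - f W - f V + f Z := by ring
  show |(f U - f V) - (f W - f Z)| ≤ _
  rw [hrw]
  refine key.trans ?_
  rw [Finset.sum_add_distrib]
  -- (1) the `h`-term: two-pin exchange + three-factor convolution
  have hK : ∀ e e', ∑ X ∈ Finset.univ.filter (fun X => e ∈ X ∧ e' ∈ X), h X ≤ Hc * Real.exp (-(2 * μ * d e e')) := hpin2
  have h1 := sum_mul_sum_mul_sum_supp_le (fun X : Finset (PBond (F.P K) 0) => X) h (s b) (s b')
    (fun e e' => Hc * Real.exp (-(2 * μ * d e e'))) (hs0 b) (hs0 b') hK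
  have h1' : ∑ e, ∑ e', s b e * s b' e' * (Hc * Real.exp (-(2 * μ * d e e'))) =
      σ J ^ 2 * Hc * ∑ e, ∑ e', Real.exp (-(2 * μ * d (π b) e)) * Real.exp (-(2 * μ * d e e')) * Real.exp (-(2 * μ * d e' (π b'))) := by
    rw [Finset.mul_sum]
    refine Finset.sum_congr rfl fun e _ => ?_
    rw [Finset.mul_sum]
    refine Finset.sum_congr rfl fun e' _ => ?_
    simp only [hs]
    rw [hdsym (π b') e']
    ring
  have hconv := exp_convolution_le d μ C' hμ hd0 hdtri hdsum' (π b) (π b')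
  have hterm1 : ∑ X, h X * (∑ e ∈ X, s b e) * (∑ e' ∈ X, s b' e') ≤ σ J ^ 2 * Hc * (C' ^ 2 * Real.exp (-(μ * d (π b) (π b')))) := by
    refine h1.trans ?_
    rw [h1']
    exact mul_le_mul_of_nonneg_left hconv (mul_nonneg (sq_nonneg _) hHc)
  -- (2) the `ℓ`-term: one-pin exchange + two-factor convolution
  have hB2 : ∑ e, s₂ b b' e ≤ σ₂ J * (C' * Real.exp (-(μ * d (π b) (π b')))) := by
    simp only [hs₂]
    rw [← Finset.mul_sum]
    exact mul_le_mul_of_nonneg_left (exp_convolution_two_le d μ C' hμ hd0 hdtri hdsum' (π b) (π b')) (hσ₂0 J)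
  have hterm2 : ∑ X, ℓ X * ∑ e ∈ X, s₂ b b' e ≤ A * (σ₂ J * (C' * Real.exp (-(μ * d (π b) (π b'))))) :=
    sum_mul_sum_supp_le (fun X : Finset (PBond (F.P K) 0) => X) ℓ (s₂ b b') A _
      (fun e => mul_nonneg (hσ₂0 J) (mul_nonneg (Real.exp_pos _).le (Real.exp_pos _).le)) hpin1 hB2 hA
  -- (3) compare the exponents: `κ·tdist ≤ μ·d(πb, πb')`
  have hexp : Real.exp (-(μ * d (π b) (π b'))) ≤ Real.exp (-(κ * (b.src.tdist b'.src : ℝ))) := by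
    rw [Real.exp_le_exp]; linarith [hdcmp b b']
  have hφ1 : 0 ≤ σ J ^ 2 * Hc * C' ^ 2 := mul_nonneg (mul_nonneg (sq_nonneg _) hHc) (sq_nonneg _)
  have hφ2 : 0 ≤ A * (σ₂ J * C') := mul_nonneg hA (mul_nonneg (hσ₂0 J) hC'0)
  calc ∑ X, h X * (∑ e ∈ X, s b e) * (∑ e' ∈ X, s b' e') + ∑ X, ℓ X * ∑ e ∈ X, s₂ b b' e
      ≤ σ J ^ 2 * Hc * (C' ^ 2 * Real.exp (-(μ * d (π b) (π b')))) + A * (σ₂ J * (C' * Real.exp (-(μ * d (π b) (π b'))))) :=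
        add_le_add hterm1 hterm2
    _ = (σ J ^ 2 * Hc * C' ^ 2 + A * (σ₂ J * C')) * Real.exp (-(μ * d (π b) (π b'))) := by ring
    _ ≤ (σ J ^ 2 * Hc * C' ^ 2 + A * (σ₂ J * C')) * Real.exp (-(κ * (b.src.tdist b'.src : ℝ))) :=
        mul_le_mul_of_nonneg_left hexp (add_nonneg hφ1 hφ2)
    _ = (Hc * C' ^ 2 * σ J ^ 2 + A * C' * σ₂ J) * Real.exp (-(κ * (b.src.tdist b'.src : ℝ))) := by ring

end Summit.QuantumFields.YangMills.Theorems.FluctuationComparisonRegPrIntLBackgroundFormKnit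

end
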